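import Summits.Ventures.Crystal3D.Theorems.StickyWulffConstantNoReconstructionGainTiltedFilm
import Summits.Ventures.Crystal3D.Theorems.StickyWulffConstantNoReconstructionGainWindowBarlowLocal
import HarnessLib

/-!
# Single-family Barlow films when every registry-up slot is `ν`-upward: the layer order certifies

HONEST FRAMING. Part of the venture `Summits/Ventures/Crystal3D` (cell `crystal3d-full`), helper
`--supports` the crux `NoReconstructionGain` (stmt-Ventures-19144, route
`route-Ventures-StickyWulffConstant`), line `adhesion`; continuation of `…BasalBarlowFilm`,
`…WindowBarlowFilm` (plain `ν`-height on basal ∪ window) and `…TiltedFilm`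
(`tiltedBarlowFilm_adhesion`: ball-by-ball certificates along a tilted grading `ν'`).

Regime.  `α = √(2/3) ν₃`, `β_τ = ⟪τ, ν⟫` for `τ` in the hollow triple `T = {w, w − u, w − v}`.
Here: `α + β_τ > 0` for all three `τ` — every REGISTRY-UP contact vector `N + τ` of
`Λ₀ = fccStacking 1 √(2/3)` is `ν`-upward ("`C = 0`": the basal cone `max |β| < α` together with
the lobes beyond `54.7°` around the hollow azimuths where one hollow value exceeds `α`, about `9 %`
of directions more per family).  Grading: the LAYER ORDER — the linear height along
`ν' ∝ ν + 10 e₃` (basal axis first, `ν` breaks in-plane ties), for which every ball of a film in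
`B = Λ₀ ∪ (Λ₀ + w) ∪ (Λ₀ − w)` is "locally basal" (`ν'₃² > 1/3`), so `tiltedBarlowFilm_adhesion`
applies as soon as every substrate–film contact is `ν'`-upward.  The only contacts that are not are
OVERHANGS `q = p − N + τ` (a film ball in the twin-DOWN slot of a substrate ball, possible only for
the hollow vector with `β_τ > α`); they are excluded by the substrate itself: the registry-down
neighbour `p − N − τ'` (`τ' ≠ τ`) of `p` sits at distance `√(1/3)` from `q`.  Hence the hypothesis

  `hclos` : every substrate ball touching the film has its three registry-down lattice
  neighbours `p − N − τ` in `P`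

(one-step downward closure; automatic for the slab sample except within one bond of its lateral rim —
the `C ρ` bookkeeping of that rim is NOT done here):

* `basal_sub_mem` — `B − B ⊆ B` (nine coset cases);
* `nTiltBarlowFilm_adhesion` (**the rung**, registered by name): for every unit `ν` with
  `α + β_τ > 0` (all `τ ∈ T`), every finite unit packing `X ⊇ P` around the `ν`-slab sample whose
  film lies in `B` and above the cut, and which satisfies `hclos`: `#cross(P, X \ P) ≤ D(X \ P) + C ρ`
  (with the constants of `tiltedBarlowFilm_adhesion`, i.e. `C = 0`).

Numbers (lead folder calc/slotrule.py: per-normal enumeration of all film-ball situations above a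
half-space substrate, with substrate exclusion): the layer order certifies every `B`-film at all 852
tested normals with `C = 0` and at none with `C ≥ 1`; together with the window rung and two further
one-pair modifications of the `ν`-rule (regimes `C ≥ 1`, to follow) some position-independent slot
rule exists at every one of 792 grid normals.

WHAT THIS IS NOT: the rim term for the slab sample (needs a lattice-point count in an annulus for
general `ν`); regimes with an overhanging registry slot (`C ≥ 1`); films mixing families; F-C1 not moved.
-/

noncomputable section

namespace Summit.Ventures.Crystal3D.Theorems

open Summit.Ventures.Crystal3D Finset
open Literature.MathematicalPhysics.StatisticalMechanics (barlowPos barlowStacking fccStacking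
  barlowOffset triangularVec₁ triangularVec₂ layerNormal constHagg haggLabel_const barlowPos_apply_zero
  barlowPos_apply_one barlowPos_apply_two three_smul_barlowOffset orderedContacts contactDeficiency)
open scoped InnerProductSpace

/-! ### `B − B ⊆ B` -/

/-- **`B` is closed under differences**: for `q, x ∈ Λ₀ ∪ (Λ₀ + w) ∪ (Λ₀ − w)` also
`x − q ∈ Λ₀ ∪ (Λ₀ + w) ∪ (Λ₀ − w)`. -/
theorem basal_sub_mem {q x : EuclideanSpace ℝ (Fin 3)}
    (hq : q ∈ fccStacking 1 (Real.sqrt (2 / 3)) ∨ q - barlowOffset 1 ∈ fccStacking 1 (Real.sqrt (2 / 3)) ∨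
      q + barlowOffset 1 ∈ fccStacking 1 (Real.sqrt (2 / 3)))
    (hx : x ∈ fccStacking 1 (Real.sqrt (2 / 3)) ∨ x - barlowOffset 1 ∈ fccStacking 1 (Real.sqrt (2 / 3)) ∨
      x + barlowOffset 1 ∈ fccStacking 1 (Real.sqrt (2 / 3))) :
    x - q ∈ fccStacking 1 (Real.sqrt (2 / 3)) ∨ x - q - barlowOffset 1 ∈ fccStacking 1 (Real.sqrt (2 / 3)) ∨
      x - q + barlowOffset 1 ∈ fccStacking 1 (Real.sqrt (2 / 3)) := by
  set Λ := fccStacking 1 (Real.sqrt (2 / 3)) with hΛ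
  set w : EuclideanSpace ℝ (Fin 3) := barlowOffset 1 with hw
  have h3w : (3 : ℝ) • w ∈ Λ := three_barlowOffset_mem
  rcases hq with hq | hq | hq <;> rcases hx with hx | hx | hx
  · exact Or.inl (fcc_sub_site_mem hx hq)
  · exact Or.inr (Or.inl (by
      have := fcc_sub_site_mem hx hq; rwa [show x - w - q = x - q - w by abel] at this))
  · exact Or.inr (Or.inr (by
      have := fcc_sub_site_mem hx hq; rwa [show x + w - q = x - q + w by abel] at this))
  · exact Or.inr (Or.inr (by
      have := fcc_sub_site_mem hx hq; rwa [show x - (q - w) = x - q + w by abel] at this))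
  · exact Or.inl (by have := fcc_sub_site_mem hx hq; rwa [show x - w - (q - w) = x - q by abel] at this)
  · refine Or.inr (Or.inl ?_)
    have h1 := fcc_sub_site_mem hx hq
    have h2 := fcc_sub_site_mem h1 h3w
    rwa [show x + w - (q - w) - (3 : ℝ) • w = x - q - w by module] at h2
  · exact Or.inr (Or.inl (by
      have := fcc_sub_site_mem hx hq; rwa [show x - (q + w) = x - q - w by abel] at this))
  · refine Or.inr (Or.inr ?_)
    have h1 := fcc_sub_site_mem hx hq
    have h2 := fcc_add_site_mem h1 h3w
    rwa [show x - w - (q + w) + (3 : ℝ) • w = x - q + w by module] at h2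
  · exact Or.inl (by have := fcc_sub_site_mem hx hq; rwa [show x + w - (q + w) = x - q by abel] at this)

/-! ### Third coordinates of the contact vectors -/

/-- The hollow vectors are horizontal. -/
theorem hollow_apply_two {τ : EuclideanSpace ℝ (Fin 3)}
    (hτ : τ ∈ ([barlowOffset 1, barlowOffset 1 - barlowPos 1 (Real.sqrt (2 / 3)) constHagg 0 1 0,
      barlowOffset 1 - barlowPos 1 (Real.sqrt (2 / 3)) constHagg 0 0 1] : List (EuclideanSpace ℝ (Fin 3)))) :
    τ 2 = 0 := by
  simp only [List.mem_cons, List.mem_nil_iff, or_false] at hτ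
  rcases hτ with rfl | rfl | rfl <;> simp [barlowOffset, barlowPos_apply_two]

/-- The interlayer vector has third coordinate `√(2/3)`. -/
theorem layerNormal_apply_two : (layerNormal (Real.sqrt (2 / 3)) : EuclideanSpace ℝ (Fin 3)) 2 = Real.sqrt (2 / 3) := by
  simp [layerNormal]

/-! ### The rung -/

/-- **The atom for single-family Barlow films in the regime `α + β_τ > 0` (all registry-up slots
`ν`-upward), via the layer order** (registered by name on stmt-Ventures-19144).  Hypotheses: the
film lies in `Λ₀ ∪ (Λ₀ ± w)` and above the cut, and every substrate ball touching a film ball has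
its three registry-down lattice neighbours in `P` (one-step downward closure — the slab sample off
its lateral rim).  Constants: those of `tiltedBarlowFilm_adhesion`. -/
theorem nTiltBarlowFilm_adhesion :
    ∃ R C : ℝ, 1 ≤ R ∧ ∀ ν : EuclideanSpace ℝ (Fin 3), ‖ν‖ = 1 → ∀ ρ : ℝ, R ≤ ρ →
      ∀ X P : Finset (EuclideanSpace ℝ (Fin 3)),
      (∀ p ∈ X, ∀ q ∈ X, p ≠ q → 1 ≤ dist p q) → P ⊆ X →
      (∀ p, p ∈ P ↔ (p ∈ fccStacking 1 (Real.sqrt (2 / 3)) ∧ -(2 * R) ≤ ⟪p, ν⟫_ℝ ∧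
        ⟪p, ν⟫_ℝ ≤ -R ∧ ‖p‖ ^ 2 - ⟪p, ν⟫_ℝ ^ 2 ≤ ρ ^ 2)) →
      (∀ τ ∈ ([barlowOffset 1, barlowOffset 1 - barlowPos 1 (Real.sqrt (2 / 3)) constHagg 0 1 0,
          barlowOffset 1 - barlowPos 1 (Real.sqrt (2 / 3)) constHagg 0 0 1] : List (EuclideanSpace ℝ (Fin 3))),
        0 < Real.sqrt (2 / 3) * ν 2 + ⟪τ, ν⟫_ℝ) →
      (∀ q ∈ X \ P, q ∈ fccStacking 1 (Real.sqrt (2 / 3)) ∨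
        q - barlowOffset 1 ∈ fccStacking 1 (Real.sqrt (2 / 3)) ∨
        q + barlowOffset 1 ∈ fccStacking 1 (Real.sqrt (2 / 3))) →
      (∀ q ∈ X \ P, -R < ⟪q, ν⟫_ℝ) →
      (∀ p ∈ P, ∀ q ∈ X \ P, dist p q = 1 →
        ∀ τ ∈ ([barlowOffset 1, barlowOffset 1 - barlowPos 1 (Real.sqrt (2 / 3)) constHagg 0 1 0,
          barlowOffset 1 - barlowPos 1 (Real.sqrt (2 / 3)) constHagg 0 0 1] : List (EuclideanSpace ℝ (Fin 3))),
          p - layerNormal (Real.sqrt (2 / 3)) - τ ∈ P) →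
      ((((P ×ˢ (X \ P)).filter fun pq => dist pq.1 pq.2 = 1).card : ℕ) : ℝ) ≤
        contactDeficiency (X \ P) + C * ρ := by
  classical
  obtain ⟨R, C, hR, h⟩ := tiltedBarlowFilm_adhesion
  refine ⟨R, C, hR, fun ν hν ρ hρ X P hX hPX hP hC0 hfilm habove hclos => ?_⟩
  -- names
  set Tl : List (EuclideanSpace ℝ (Fin 3)) := [barlowOffset 1,
    barlowOffset 1 - barlowPos 1 (Real.sqrt (2 / 3)) constHagg 0 1 0,
    barlowOffset 1 - barlowPos 1 (Real.sqrt (2 / 3)) constHagg 0 0 1] with hTl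
  have hh : 0 < Real.sqrt (2 / 3) := Real.sqrt_pos.2 (by norm_num)
  -- every ball is a basal Barlow position
  have hB : ∀ y ∈ X, y ∈ fccStacking 1 (Real.sqrt (2 / 3)) ∨
      y - barlowOffset 1 ∈ fccStacking 1 (Real.sqrt (2 / 3)) ∨
      y + barlowOffset 1 ∈ fccStacking 1 (Real.sqrt (2 / 3)) := by
    intro y hy
    by_cases hyP : y ∈ P
    · exact Or.inl ((hP y).1 hyP).1
    · exact hfilm y (mem_sdiff.2 ⟨hy, hyP⟩)
  -- the tilted grading `ν' ∝ ν + 10 e₃`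
  set e₃ : EuclideanSpace ℝ (Fin 3) := EuclideanSpace.single (2 : Fin 3) (1 : ℝ) with he₃
  set V : EuclideanSpace ℝ (Fin 3) := ν + (10 : ℝ) • e₃ with hV
  have hin3 : ∀ u : EuclideanSpace ℝ (Fin 3), ⟪u, e₃⟫_ℝ = u 2 := fun u => by
    simp [he₃, EuclideanSpace.inner_single_right]
  have he₃n : ‖e₃‖ = 1 := by simp [he₃]
  have hν2 : -1 ≤ ν 2 := by
    have h1 : |⟪ν, e₃⟫_ℝ| ≤ ‖ν‖ * ‖e₃‖ := abs_real_inner_le_norm ν e₃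
    rw [hin3, hν, he₃n, one_mul] at h1
    linarith [neg_abs_le (ν 2)]
  have hVV : ‖V‖ ^ 2 = 101 + 20 * ν 2 := by
    rw [hV, norm_add_sq_real, norm_smul, real_inner_smul_right, hin3, hν, he₃n, Real.norm_eq_abs,
      abs_of_pos (by norm_num : (0 : ℝ) < 10)]
    ring
  have hVpos : 0 < ‖V‖ := by nlinarith [norm_nonneg V, hVV, hν2]
  set L : ℝ := ‖V‖ with hL
  set ν' : EuclideanSpace ℝ (Fin 3) := L⁻¹ • V with hν'
  have hν'n : ‖ν'‖ = 1 := by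
    rw [hν', norm_smul, Real.norm_eq_abs, abs_inv, abs_of_pos hVpos, inv_mul_cancel₀ hVpos.ne']
  have hinner' : ∀ u : EuclideanSpace ℝ (Fin 3), ⟪u, ν'⟫_ℝ = L⁻¹ * (⟪u, ν⟫_ℝ + 10 * u 2) := fun u => by
    rw [hν', real_inner_smul_right, hV, inner_add_right, real_inner_smul_right, hin3]
  have hν'2 : 1 / 3 < ν' 2 ^ 2 := by
    have e : ν' 2 = L⁻¹ * (ν 2 + 10) := by simp [hν', hV, he₃]; ring
    have key : L ^ 2 < 3 * (ν 2 + 10) ^ 2 := by rw [hL, hVV]; nlinarith [hν2]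
    have hL2 : 0 < L ^ 2 := by positivity
    rw [e, mul_pow, inv_pow, ← div_eq_inv_mul, lt_div_iff₀ hL2]
    linarith
  -- substrate–film contacts are `ν'`-upward
  have hplug' : ∀ q ∈ X \ P, ∀ p ∈ P, dist q p = 1 → ⟪p, ν'⟫_ℝ < ⟪q, ν'⟫_ℝ := by
    intro q hq p hp hd
    rw [hinner', hinner']
    refine mul_lt_mul_of_pos_left ?_ (inv_pos.2 hVpos)
    obtain ⟨hpΛ, -, hpt, -⟩ := (hP p).1 hp
    have hqt := habove q hq
    have hqP : q ∉ P := (mem_sdiff.1 hq).2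
    have hqX : q ∈ X := (mem_sdiff.1 hq).1
    have hup : 0 < ⟪q, ν⟫_ℝ - ⟪p, ν⟫_ℝ := by linarith
    have hd' : dist p q = 1 := by rw [dist_comm]; exact hd
    have h18 := basal_unit_vectors (Or.inl hpΛ) (hfilm q hq) hd'
    have hsub2 : (q - p) 2 = q 2 - p 2 := by simp
    rcases basal_polar_or_inplane h18 with ⟨c, hc, hcq⟩ | ⟨τ, hτ, hτq⟩
    · -- in-plane: same layer
      have h2 : (q - p) 2 = 0 := by
        simp only [List.mem_cons, List.mem_nil_iff, or_false] at hc
        rcases hc with rfl | rfl | rfl <;> rcases hcq with e | e <;> simp [e, barlowPos_apply_two]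
      rw [hsub2] at h2
      linarith
    · have hτ2 := hollow_apply_two hτ
      have hN2 := layerNormal_apply_two
      rcases hτq with e | e | e | e
      · -- `q − p = N + τ`: one layer up
        have h2 : (q - p) 2 = Real.sqrt (2 / 3) := by rw [e, PiLp.add_apply, hN2, hτ2, add_zero]
        rw [hsub2] at h2
        linarith
      · -- `q − p = N − τ`: one layer up
        have h2 : (q - p) 2 = Real.sqrt (2 / 3) := by rw [e, PiLp.sub_apply, hN2, hτ2, sub_zero]
        rw [hsub2] at h2
        linarith
      · -- `q − p = −(N + τ)`: a registry overhang, impossible since `α + β_τ > 0`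
        exfalso
        have hc := hC0 τ hτ
        have : ⟪q - p, ν⟫_ℝ = -(Real.sqrt (2 / 3) * ν 2 + ⟪τ, ν⟫_ℝ) := by
          rw [e, inner_neg_left, inner_add_left, inner_layerNormal_left]
        rw [inner_sub_left] at this
        linarith
      · -- `q − p = −(N − τ)`: a twin overhang; the registry-down neighbour `p − N − τ'` of `p` is
        -- within `√(1/3)` of `q`
        exfalso
        -- a second hollow vector `τ'` with `‖τ + τ'‖² = 1/3`
        obtain ⟨τ', hτ', hn⟩ : ∃ τ' ∈ Tl, ‖τ + τ'‖ ^ 2 = 1 / 3 := by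
          have hsum := hollow_triple_sum
          simp only [List.mem_cons, List.mem_nil_iff, or_false] at hτ
          rcases hτ with rfl | rfl | rfl
          · refine ⟨barlowOffset 1 - barlowPos 1 (Real.sqrt (2 / 3)) constHagg 0 1 0, by simp [hTl], ?_⟩
            rw [show barlowOffset 1 + (barlowOffset 1 - barlowPos 1 (Real.sqrt (2 / 3)) constHagg 0 1 0) =
              -(barlowOffset 1 - barlowPos 1 (Real.sqrt (2 / 3)) constHagg 0 0 1) by
                rw [← sub_eq_zero]; rw [← hsum]; abel, norm_neg]
            exact norm_sq_barlowOffset_sub_v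
          · refine ⟨barlowOffset 1 - barlowPos 1 (Real.sqrt (2 / 3)) constHagg 0 0 1, by simp [hTl], ?_⟩
            rw [show barlowOffset 1 - barlowPos 1 (Real.sqrt (2 / 3)) constHagg 0 1 0 +
                (barlowOffset 1 - barlowPos 1 (Real.sqrt (2 / 3)) constHagg 0 0 1) = -barlowOffset 1 by
                rw [← sub_eq_zero]; rw [← hsum]; abel, norm_neg]
            exact norm_sq_barlowOffset'
          · refine ⟨barlowOffset 1, by simp [hTl], ?_⟩
            rw [show barlowOffset 1 - barlowPos 1 (Real.sqrt (2 / 3)) constHagg 0 0 1 + barlowOffset 1 =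
              -(barlowOffset 1 - barlowPos 1 (Real.sqrt (2 / 3)) constHagg 0 1 0) by
                rw [← sub_eq_zero]; rw [← hsum]; abel, norm_neg]
            exact norm_sq_barlowOffset_sub_u
        have hℓP : p - layerNormal (Real.sqrt (2 / 3)) - τ' ∈ P := hclos p hp q hq hd' τ' hτ'
        have hℓX : p - layerNormal (Real.sqrt (2 / 3)) - τ' ∈ X := hPX hℓP
        have hne : q ≠ p - layerNormal (Real.sqrt (2 / 3)) - τ' := fun hqe => hqP (hqe ▸ hℓP)
        have h1 := hX q hqX _ hℓX hne
        have hdq : q - (p - layerNormal (Real.sqrt (2 / 3)) - τ') = τ + τ' := by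
          have : q = p + (q - p) := by abel
          rw [this, e]; abel
        rw [dist_eq_norm, hdq] at h1
        nlinarith [norm_nonneg (τ + τ')]
  -- every film ball is "locally basal" for `ν'`
  have hcert' : ∀ q ∈ X \ P,
      (∃ W : Finset (EuclideanSpace ℝ (Fin 3)), W.card ≤ 6 ∧
          ∀ x ∈ X, dist q x = 1 → (x ∉ P ∧ ⟪q, ν'⟫_ℝ < ⟪x, ν'⟫_ℝ) ∨ ∃ w ∈ W, x = q + w ∨ x = q - w) ∨
      (1 / 3 < ν' 2 ^ 2 ∧ ∀ x ∈ X, dist q x = 1 → (x ∉ P ∧ ⟪q, ν'⟫_ℝ < ⟪x, ν'⟫_ℝ) ∨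
          x - q ∈ fccStacking 1 (Real.sqrt (2 / 3)) ∨
          x - q - barlowOffset 1 ∈ fccStacking 1 (Real.sqrt (2 / 3)) ∨
          x - q + barlowOffset 1 ∈ fccStacking 1 (Real.sqrt (2 / 3))) ∨
      (1 / 3 < (2 * ⟪ν', barlowPos 1 (Real.sqrt (2 / 3)) constHagg 1 0 0⟫_ℝ * Real.sqrt (2 / 3) - ν' 2) ^ 2 ∧
        ∀ x ∈ X, dist q x = 1 → (x ∉ P ∧ ⟪q, ν'⟫_ℝ < ⟪x, ν'⟫_ℝ) ∨
          x - q ∈ fccStacking 1 (Real.sqrt (2 / 3)) ∨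
          x - q - ((2 / 3 : ℝ) • barlowPos 1 (Real.sqrt (2 / 3)) constHagg 1 0 0 - barlowOffset 1) ∈
            fccStacking 1 (Real.sqrt (2 / 3)) ∨
          x - q + ((2 / 3 : ℝ) • barlowPos 1 (Real.sqrt (2 / 3)) constHagg 1 0 0 - barlowOffset 1) ∈
            fccStacking 1 (Real.sqrt (2 / 3))) ∨
      (1 / 3 < ν' 2 ^ 2 ∧
        1 / 3 < (2 * ⟪ν', barlowPos 1 (Real.sqrt (2 / 3)) constHagg 1 0 0⟫_ℝ * Real.sqrt (2 / 3) - ν' 2) ^ 2 ∧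
        ∀ x ∈ X, dist q x = 1 → (x ∉ P ∧ ⟪q, ν'⟫_ℝ < ⟪x, ν'⟫_ℝ) ∨
          x - q ∈ fccStacking 1 (Real.sqrt (2 / 3)) ∨
          x - q - barlowOffset 1 ∈ fccStacking 1 (Real.sqrt (2 / 3)) ∨
          x - q + barlowOffset 1 ∈ fccStacking 1 (Real.sqrt (2 / 3)) ∨
          x - q - ((2 / 3 : ℝ) • barlowPos 1 (Real.sqrt (2 / 3)) constHagg 1 0 0 - barlowOffset 1) ∈
            fccStacking 1 (Real.sqrt (2 / 3)) ∨
          x - q + ((2 / 3 : ℝ) • barlowPos 1 (Real.sqrt (2 / 3)) constHagg 1 0 0 - barlowOffset 1) ∈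
            fccStacking 1 (Real.sqrt (2 / 3))) := by
    intro q hq
    exact Or.inr (Or.inl ⟨hν'2, fun x hx _ => Or.inr (basal_sub_mem (hB q (mem_sdiff.1 hq).1) (hB x hx))⟩)
  exact h ν hν ρ hρ X P hX hPX hP ν' hν'n hplug' hcert'

end Summit.Ventures.Crystal3D.Theorems

end
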